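import Summits.QuantumAdvantage.QuantumAdvantage.Theorems.CubicForrelationNearExactIsExactTwelveLevelFiveOffFlat930

/-!
# Crux `CubicForrelation.NearExactIsExact` (stmt-QuantumAdvantage-14043) — n = 12, level 5 AT `Φ ≥ 930/1024`: the odd hyperplane and off-`P`
  exactness at budget `Σ e² ≤ 3008` (the boundary value included)

Certificate seat `b2b-cforr-cert` (gen 20).  HONEST FRAMING: lemmas (standard axioms) about cubic Boolean pairs on 12 bits — the non-strict
versions (`Φ ≥ 930/1024`, budget `Σ e² ≤ 3008`, off-`P` energy `≤ 960 < 1024`) of gen 18's `tw19_exists_even_930` / `tw19_hyperplane_930` /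
`tw19_off_flat_930` (…TwelveLevelFiveOffFlat930, which assume `Φ > 930/1024`); VERBATIM the same arguments (the three-point argument only
needs off-`P` energy `< 1024`).  They feed the level-5 analysis AT the value `930/1024` (…TwelveLevelFive930Residual / …Dead); finite-slice
bookkeeping, NOT summit progress, NO new value of `θ₁₂` claimed here.

References: J. Ax (1964) / R. J. McEliece (1972); MacWilliams–Sloane (1977) Ch. 13 §3; R. O'Donnell (2014) §3.3.  Everything below is
proved from Mathlib and the tree; axioms are the standard three.
-/

set_option linter.dupNamespace false -- D-0017: single-problem summit ⇒ `QuantumAdvantage.QuantumAdvantage` by design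

noncomputable section

namespace Summit.QuantumAdvantage.QuantumAdvantage.Theorems.CubicForrelation.NearExactIsExact

open Finset
open Literature.Computability.QuantumComplexity
open Literature.Computability.QuantumComplexity.BuzetChailloux (bxor zeroVec bxor_bxor_cancel_left bxor_zeroVec zeroVec_bxor bxor_comm
  bxor_self twist_zeroVec_right twist_bxor_right)
open Literature.Computability.QuantumComplexity.DerivativeWalsh (W)

/-! ### The odd set is a hyperplane (budget `Σ e² ≤ 3008`, i.e. `Φ ≥ 930/1024`) -/

/-- At `Φ ≥ 930/1024` a level-5 side has an EVEN point: otherwise `e = u' − 2(−1)^f` is odd everywhere and `Σ e² ≥ 4096 > 3007`.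
[this work] -/
theorem tw20_exists_even_930le (f g : (Fin (6 + 6) → Bool) → Bool) (u' : (Fin (6 + 6) → Bool) → ℤ)
    (hu' : ∀ x, W (fun y => signOf (g y)) x = (2 : ℝ) ^ 5 * (u' x : ℝ)) (hΦ : (930 / 1024 : ℝ) ≤ forrelation f g) :
    ∃ y, ¬ Odd (u' y) := by
  classical
  set u : (Fin (6 + 6) → Bool) → ℤ := fun x => 2 * u' x with hudef
  have hu : ∀ x, W (fun y => signOf (g y)) x = (2 : ℝ) ^ 4 * (u x : ℝ) := by
    intro x; rw [hu' x]; simp only [u]; push_cast; ring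
  set e : (Fin (6 + 6) → Bool) → ℤ := fun x => u' x - 2 * sZ (f x) with hedef
  have hbud := tw12_budget f g u hu
  have h4e : ∀ x, (u x - 4 * sZ (f x)) ^ 2 = 4 * e x ^ 2 := fun x => by simp only [u, e]; ring
  have hBR : ((∑ x, e x ^ 2 : ℤ) : ℝ) = 32768 * (1 - forrelation f g) := by
    have h' : ((∑ x, (u x - 4 * sZ (f x)) ^ 2 : ℤ) : ℝ) = 4 * ((∑ x, e x ^ 2 : ℤ) : ℝ) := by
      rw [sum_congr rfl fun x _ => h4e x, ← mul_sum]; push_cast; ring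
    rw [h'] at hbud
    linarith
  have hB_le : (∑ x, e x ^ 2 : ℤ) ≤ 3008 := by
    have h' : ((∑ x, e x ^ 2 : ℤ) : ℝ) ≤ 3008 := by rw [hBR]; linarith
    exact_mod_cast h'
  by_contra hall
  push Not at hall
  have hsq1 : ∀ x, 1 ≤ e x ^ 2 := by
    intro x
    have hodd : Odd (e x) := Int.odd_sub.2 (iff_of_true (hall x) ⟨sZ (f x), two_mul _⟩)
    have h0 := Int.odd_iff.1 hodd
    have : e x ≤ -1 ∨ 1 ≤ e x := by omega
    have := tp_sq_ge (k := 1) (by norm_num) this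
    linarith
  have h1 : ∑ x, (1 : ℤ) ≤ ∑ x, e x ^ 2 := sum_le_sum fun x _ => hsq1 x
  rw [sum_const, card_univ, Fintype.card_fun, Fintype.card_bool, Fintype.card_fin, nsmul_eq_mul, mul_one] at h1
  norm_num at h1
  linarith

/-- **The odd set is an affine hyperplane** at `Φ ≥ 930/1024`: `{u' odd} = {x : (−1)^{γ·x} = t}`, `γ ≠ 0`, `t = ±1`. [this work] -/
theorem tw20_hyperplane_930le (f g : (Fin (6 + 6) → Bool) → Bool) (hg : IsDegLeFun 3 g) (u' : (Fin (6 + 6) → Bool) → ℤ)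
    (hu' : ∀ x, W (fun y => signOf (g y)) x = (2 : ℝ) ^ 5 * (u' x : ℝ)) (hodd : ∃ x, Odd (u' x))
    (hΦ : (930 / 1024 : ℝ) ≤ forrelation f g) :
    ∃ (γ : Fin (6 + 6) → Bool) (t : ℝ), (t = 1 ∨ t = -1) ∧ γ ≠ zeroVec ∧ ∀ x, (Odd (u' x) ↔ twist γ x = t) := by
  have hℓ : IsDegLeFun 1 (fun x => decide (Odd (u' x))) :=
    stub_walshTower stub_axParity (6 + 6) 5 1 g u' hg hu' (by intro k hk hkn; omega)
  obtain ⟨c, b, hcb⟩ := stub_affineForm (6 + 6) _ hℓ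
  have hsb : signOf b = 1 ∨ signOf b = -1 := by cases b <;> simp [signOf]
  have hiff : ∀ x, (Odd (u' x) ↔ twist c x = -signOf b) := by
    intro x
    have h1 := hcb x
    constructor
    · intro hx
      have h2 : signOf (decide (Odd (u' x))) = -1 := (tw59_signOf_eq_neg_one_iff _).2 (decide_eq_true hx)
      rw [h2] at h1
      rcases hsb with hs | hs <;> rw [hs] at h1 ⊢ <;> linarith
    · intro hx
      by_contra hno
      have h2 : signOf (decide (Odd (u' x))) = 1 := by simp [signOf, hno]
      rw [h2, hx] at h1
      rcases hsb with hs | hs <;> rw [hs] at h1 <;> linarith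
  refine ⟨c, -signOf b, ?_, ?_, hiff⟩
  · rcases hsb with hs | hs <;> rw [hs] <;> norm_num
  · intro hc
    have hconst : ∀ x y, (Odd (u' x) ↔ Odd (u' y)) := by
      intro x y
      rw [hiff x, hiff y, hc, twist_comm zeroVec x, twist_comm zeroVec y, twist_zeroVec_right, twist_zeroVec_right]
    obtain ⟨x, hx⟩ := hodd
    obtain ⟨y, hy⟩ := tw20_exists_even_930le f g u' hu' hΦ
    exact hy ((hconst x y).1 hx)

/-! ### Level 5 at `Φ ≥ 930/1024`: off the hyperplane the pair is exact -/

/-- **Level 5 with `Φ ≥ 930/1024`: off the hyperplane the pair is exact.**  Cubic `f, g : 𝔽₂¹² → 𝔽₂`, `W_g = 32·u'` with some `u'(x)`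
odd, `Φ(f,g) ≥ 930/1024` (off-`P` energy `≤ 960 < 4·256`).  Then `u' = 2(−1)^f` wherever `u'` is even.  Finite-slice statement, NOT summit
progress. [this work] -/
theorem tw20_off_flat_930le (f g : (Fin (6 + 6) → Bool) → Bool) (hf : IsDegLeFun 3 f) (hg : IsDegLeFun 3 g)
    (u' : (Fin (6 + 6) → Bool) → ℤ) (hu' : ∀ x, W (fun y => signOf (g y)) x = (2 : ℝ) ^ 5 * (u' x : ℝ))
    (hodd : ∃ x, Odd (u' x)) (hΦ : (930 / 1024 : ℝ) ≤ forrelation f g) :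
    ∀ y, ¬ Odd (u' y) → u' y = 2 * sZ (f y) := by
  classical
  -- `u = 2u'` at the Ax level `4`; residual `e = u' − 2s`, budget `B = Σ e² = 2¹⁵(1 − Φ) ≤ 3008`
  set u : (Fin (6 + 6) → Bool) → ℤ := fun x => 2 * u' x with hudef
  have hu : ∀ x, W (fun y => signOf (g y)) x = (2 : ℝ) ^ 4 * (u x : ℝ) := by
    intro x; rw [hu' x]; simp only [u]; push_cast; ring
  set e : (Fin (6 + 6) → Bool) → ℤ := fun x => u' x - 2 * sZ (f x) with hedef
  have hbud := tw12_budget f g u hu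
  have h4e : ∀ x, (u x - 4 * sZ (f x)) ^ 2 = 4 * e x ^ 2 := fun x => by simp only [u, e]; ring
  have hBR : ((∑ x, e x ^ 2 : ℤ) : ℝ) = 32768 * (1 - forrelation f g) := by
    have h' : ((∑ x, (u x - 4 * sZ (f x)) ^ 2 : ℤ) : ℝ) = 4 * ((∑ x, e x ^ 2 : ℤ) : ℝ) := by
      rw [sum_congr rfl fun x _ => h4e x, ← mul_sum]; push_cast; ring
    rw [h'] at hbud
    linarith
  have hB_le : (∑ x, e x ^ 2 : ℤ) ≤ 3008 := by
    have h' : ((∑ x, e x ^ 2 : ℤ) : ℝ) ≤ 3008 := by rw [hBR]; linarith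
    exact_mod_cast h'
  -- the odd set `P` of `u'` is an affine hyperplane
  have hℓ : IsDegLeFun 1 (fun x => decide (Odd (u' x))) :=
    stub_walshTower stub_axParity (6 + 6) 5 1 g u' hg hu' (by intro k hk hkn; omega)
  set P := univ.filter (fun x : Fin (6 + 6) → Bool => Odd (u' x)) with hPdef
  have hmemP : ∀ x, x ∈ P ↔ Odd (u' x) := fun x => by simp [hPdef]
  have heodd : ∀ x, x ∈ P → Odd (e x) := by
    intro x hx
    exact Int.odd_sub.2 (iff_of_true ((hmemP x).1 hx) ⟨sZ (f x), two_mul _⟩)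
  have hsq1 : ∀ x, x ∈ P → 1 ≤ e x ^ 2 := by
    intro x hx
    have h0 := Int.odd_iff.1 (heodd x hx)
    have : e x ≤ -1 ∨ 1 ≤ e x := by omega
    have := tp_sq_ge (k := 1) (by norm_num) this
    linarith
  have hsplit : (∑ x, e x ^ 2 : ℤ) = ∑ x ∈ P, e x ^ 2 + ∑ x ∈ univ.filter (fun x => x ∉ P), e x ^ 2 := by
    rw [← sum_filter_add_sum_filter_not univ (fun x => x ∈ P)]
    congr 1
    exact sum_congr (by ext x; simp) fun _ _ => rfl
  have hoff_nn : 0 ≤ ∑ x ∈ univ.filter (fun x => x ∉ P), e x ^ 2 := sum_nonneg fun x _ => sq_nonneg _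
  have hPle : (#P : ℤ) ≤ 3008 := by
    have h1 : (#P : ℤ) = ∑ x ∈ P, (1 : ℤ) := by rw [sum_const, nsmul_eq_mul, mul_one]
    have h2 : ∑ x ∈ P, (1 : ℤ) ≤ ∑ x ∈ P, e x ^ 2 := sum_le_sum fun x hx => hsq1 x hx
    linarith
  have hfilt : (univ.filter fun x : Fin (6 + 6) → Bool => decide (Odd (u' x)) = true) = P := filter_congr fun x _ => by simp
  have hPge : 2048 ≤ #P := by
    obtain ⟨x₁, hx₁⟩ := hodd
    have hRM := bb_rmWeight_holds (6 + 6) 1 (fun x => decide (Odd (u' x))) hℓ ⟨x₁, decide_eq_true hx₁⟩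
    rw [hfilt] at hRM
    norm_num at hRM
    omega
  have hPc : 2048 ≤ #(univ.filter fun x : Fin (6 + 6) → Bool => x ∉ P) := by
    have hPlt : #P < 4096 := by
      have hlt' : (#P : ℤ) < 4096 := by linarith
      exact_mod_cast hlt'
    have hne : ∃ x, x ∉ P := by
      by_contra hall
      push Not at hall
      have : #P = 4096 := by
        rw [show P = univ from eq_univ_of_forall hall, card_univ, Fintype.card_fun, Fintype.card_bool, Fintype.card_fin]; norm_num
      omega
    obtain ⟨x₂, hx₂⟩ := hne
    have hℓ' : IsDegLeFun 1 (fun x => decide (Odd (u' x)) ^^ true) := tb_isDegLeFun_xor_const hℓ true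
    have hRM := bb_rmWeight_holds (6 + 6) 1 (fun x => decide (Odd (u' x)) ^^ true) hℓ'
      ⟨x₂, by have := (hmemP x₂).not.1 hx₂; simpa using this⟩
    have hfilt' : (univ.filter fun x : Fin (6 + 6) → Bool => (decide (Odd (u' x)) ^^ true) = true) =
        univ.filter fun x : Fin (6 + 6) → Bool => x ∉ P := filter_congr fun x _ => by rw [hmemP]; simp
    rw [hfilt'] at hRM
    norm_num at hRM ⊢
    omega
  have hcardP : #P = 2048 := by
    have htot : #P + #(univ.filter fun x : Fin (6 + 6) → Bool => x ∉ P) = 4096 := by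
      have h := Finset.card_filter_add_card_filter_not (s := (univ : Finset (Fin (6 + 6) → Bool))) (fun x => x ∈ P)
      rw [card_univ, Fintype.card_fun, Fintype.card_bool, Fintype.card_fin] at h
      have e1 : (univ.filter fun x : Fin (6 + 6) → Bool => x ∈ P) = P := by ext x; simp
      rw [e1] at h
      norm_num at h
      exact h
    omega
  -- `P` is a coset of an xor-closed `V` with `2¹¹` elements
  have hmw := mw_flat_of_minweight 0 (fun x => decide (Odd (u' x))) hℓ (by rw [hfilt, hcardP]; norm_num)
  rw [hfilt] at hmw
  obtain ⟨h0, hadd, hcardV, hcoset⟩ := hmw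
  set V := univ.filter (fun a : Fin (6 + 6) → Bool => ∀ x, decide (Odd (u' (bxor x a))) = decide (Odd (u' x))) with hV
  obtain ⟨xP, hxP⟩ : P.Nonempty := card_pos.1 (by rw [hcardP]; norm_num)
  have hS : P = V.image (bxor xP) := hcoset xP (decide_eq_true ((hmemP xP).1 hxP))
  rw [hcardP] at hcardV
  have hcardV11 : #V = 2 ^ 11 := by rw [hcardV]; norm_num
  -- off `P`: `16 ∣ e`, and at most three non-zero points
  have hPsum_ge : (2048 : ℤ) ≤ ∑ x ∈ P, e x ^ 2 := by
    have h1 : ∑ x ∈ P, (1 : ℤ) ≤ ∑ x ∈ P, e x ^ 2 := sum_le_sum fun x hx => hsq1 x hx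
    rw [sum_const, nsmul_eq_mul, mul_one, hcardP] at h1
    exact_mod_cast h1
  have hoff_le : ∑ x ∈ univ.filter (fun x => x ∉ P), e x ^ 2 ≤ 960 := by linarith
  have hoff16 : ∀ y, y ∉ P → (16 : ℤ) ∣ e y :=
    tw5_off_flat_16 f g hf hg u' hu' V xP h0 hadd hcardV11 hS (by linarith)
  have hsq256 : ∀ y, y ∉ P → e y ≠ 0 → 256 ≤ e y ^ 2 := by
    intro y hy hy0
    obtain ⟨k, hk⟩ := hoff16 y hy
    have hk0 : k ≠ 0 := by rintro rfl; exact hy0 (by rw [hk]; ring)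
    have : k ≤ -1 ∨ 1 ≤ k := by omega
    have := tp_sq_ge (k := 1) (by norm_num) this
    rw [hk]; nlinarith
  -- a non-zero off-`P` value is `±16`
  have hpm16 : ∀ y, y ∉ P → e y ≠ 0 → e y ^ 2 ≤ 1023 → e y = 16 ∨ e y = -16 := by
    intro y hy hy0 hle
    obtain ⟨k, hk⟩ := hoff16 y hy
    rw [hk] at hle ⊢
    have hk1 : k ≤ 1 := by nlinarith
    have hk2 : -1 ≤ k := by nlinarith
    have hk0 : k ≠ 0 := by rintro rfl; exact hy0 (by rw [hk]; ring)
    omega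
  -- `Σ_{P^c} u' ∈ 128ℤ`, `Σ_{P^c} (−1)^f ∈ 16ℤ`; traces on a coordinate hyperplane: `64ℤ`, `16ℤ`
  have h128 := tw5_annP g u' hu' (fun x => decide (Odd (u' x))) hℓ
  have hfiltF : (univ.filter fun x : Fin (6 + 6) → Bool => decide (Odd (u' x)) = false) =
      univ.filter fun x : Fin (6 + 6) → Bool => x ∉ P := filter_congr fun x _ => by rw [hmemP]; simp
  rw [hfiltF] at h128
  have hℓ' : IsDegLeFun 1 (fun x => decide (Odd (u' x)) ^^ true) := tb_isDegLeFun_xor_const hℓ true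
  have h16 := (tw5_axP (fun x => decide (Odd (u' x)) ^^ true) f hℓ' hf 0).1
  have hfiltT : (univ.filter fun x : Fin (6 + 6) → Bool => (decide (Odd (u' x)) ^^ true) = true) =
      univ.filter fun x : Fin (6 + 6) → Bool => x ∉ P := filter_congr fun x _ => by rw [hmemP]; simp
  rw [hfiltT] at h16
  have h64j : ∀ j : Fin (6 + 6), (64 : ℤ) ∣ ∑ x ∈ univ.filter (fun x : Fin (6 + 6) → Bool => x ∉ P ∧ x j = false), u' x := by
    intro j
    have h := tw15_annP2 g u' hu' (fun x => decide (Odd (u' x))) hℓ j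
    have hfj : (univ.filter fun x : Fin (6 + 6) → Bool => decide (Odd (u' x)) = false ∧ x j = false) =
        univ.filter fun x : Fin (6 + 6) → Bool => x ∉ P ∧ x j = false := filter_congr fun x _ => by rw [hmemP]; simp
    rwa [hfj] at h
  have h16j : ∀ j : Fin (6 + 6), (16 : ℤ) ∣ ∑ x ∈ univ.filter (fun x : Fin (6 + 6) → Bool => x ∉ P ∧ x j = false), sZ (f x) := by
    intro j
    have h := (tw5_axP (fun x => decide (Odd (u' x)) ^^ true) f hℓ' hf j).2
    have hfj : (univ.filter fun x : Fin (6 + 6) → Bool => (decide (Odd (u' x)) ^^ true) = true ∧ x j = false) =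
        univ.filter fun x : Fin (6 + 6) → Bool => x ∉ P ∧ x j = false := filter_congr fun x _ => by rw [hmemP]; simp
    rwa [hfj] at h
  -- the separation argument: a lone `±16` in `P^c ∩ {x_j = 0}` contradicts `Σ e ∈ 32ℤ` there
  have hsep : ∀ (j : Fin (6 + 6)) (z : Fin (6 + 6) → Bool), z ∉ P → z j = false → (e z = 16 ∨ e z = -16) →
      (∀ y, y ∉ P → y j = false → y ≠ z → e y = 0) → False := by
    intro j z hz hzj hez hzero
    have hsum : ∑ x ∈ univ.filter (fun x : Fin (6 + 6) → Bool => x ∉ P ∧ x j = false), e x = e z :=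
      sum_eq_single_of_mem z (mem_filter.2 ⟨mem_univ _, hz, hzj⟩) fun x hx hxz =>
        hzero x (mem_filter.1 hx).2.1 (mem_filter.1 hx).2.2 hxz
    have hdec : ∑ x ∈ univ.filter (fun x : Fin (6 + 6) → Bool => x ∉ P ∧ x j = false), e x =
        ∑ x ∈ univ.filter (fun x : Fin (6 + 6) → Bool => x ∉ P ∧ x j = false), u' x -
        2 * ∑ x ∈ univ.filter (fun x : Fin (6 + 6) → Bool => x ∉ P ∧ x j = false), sZ (f x) := by
      rw [mul_sum, ← sum_sub_distrib]
    obtain ⟨m, hm⟩ := h64j j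
    obtain ⟨w, hw⟩ := h16j j
    rw [hsum, hm, hw] at hdec
    rcases hez with h | h <;> rw [h] at hdec <;> omega
  intro y₀ hy₀'
  have hy₀ : y₀ ∉ P := fun h => hy₀' ((hmemP y₀).1 h)
  by_contra hne
  have hne' : e y₀ ≠ 0 := by intro h0'; apply hne; have : e y₀ = 0 := h0'; simp only [e] at this; linarith
  have hmem₀ : y₀ ∈ univ.filter (fun x : Fin (6 + 6) → Bool => x ∉ P) := mem_filter.2 ⟨mem_univ _, hy₀⟩
  -- every non-zero off-`P` value is `±16`
  have hval : ∀ y, y ∉ P → e y ≠ 0 → e y = 16 ∨ e y = -16 := fun y hy hne => hpm16 y hy hne (by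
    have h1 : e y ^ 2 ≤ ∑ x ∈ univ.filter (fun x => x ∉ P), e x ^ 2 :=
      single_le_sum (f := fun x => e x ^ 2) (fun x _ => sq_nonneg (e x)) (mem_filter.2 ⟨mem_univ _, hy⟩)
    linarith)
  have hdecomp : ∀ (T : Finset (Fin (6 + 6) → Bool)), ∑ x ∈ T, e x = ∑ x ∈ T, u' x - 2 * ∑ x ∈ T, sZ (f x) := fun T => by
    rw [mul_sum, ← sum_sub_distrib]
  by_cases hex : ∃ y₁, y₁ ∉ P ∧ y₁ ≠ y₀ ∧ e y₁ ≠ 0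
  · obtain ⟨y₁, hy₁, hy₁₀, hne₁⟩ := hex
    have hmem₁ : y₁ ∈ univ.filter (fun x : Fin (6 + 6) → Bool => x ∉ P) := mem_filter.2 ⟨mem_univ _, hy₁⟩
    have he₀ := hval y₀ hy₀ hne'
    have he₁ := hval y₁ hy₁ hne₁
    by_cases hex2 : ∃ y₂, y₂ ∉ P ∧ y₂ ≠ y₀ ∧ y₂ ≠ y₁ ∧ e y₂ ≠ 0
    · /- THREE non-zero points off `P`: everything else zero, `Σ_{P^c} e = ±16 ± 16 ± 16 ∉ 32ℤ` -/
      obtain ⟨y₂, hy₂, hy₂₀, hy₂₁, hne₂⟩ := hex2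
      have hmem₂ : y₂ ∈ univ.filter (fun x : Fin (6 + 6) → Bool => x ∉ P) := mem_filter.2 ⟨mem_univ _, hy₂⟩
      have he₂ := hval y₂ hy₂ hne₂
      have hothers : ∀ y, y ∉ P → y ≠ y₀ → y ≠ y₁ → y ≠ y₂ → e y = 0 := by
        intro y hy hyy₀ hyy₁ hyy₂
        by_contra hy0
        have h4 : e y₀ ^ 2 + e y₁ ^ 2 + e y₂ ^ 2 + e y ^ 2 ≤ ∑ x ∈ univ.filter (fun x => x ∉ P), e x ^ 2 := by
          have hsub : ({y₀, y₁, y₂, y} : Finset (Fin (6 + 6) → Bool)) ⊆ univ.filter (fun x => x ∉ P) := by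
            intro z hz
            rcases mem_insert.1 hz with rfl | hz
            · exact hmem₀
            rcases mem_insert.1 hz with rfl | hz
            · exact hmem₁
            rcases mem_insert.1 hz with rfl | hz
            · exact hmem₂
            · rw [mem_singleton.1 hz]; exact mem_filter.2 ⟨mem_univ _, hy⟩
          have := sum_le_sum_of_subset_of_nonneg hsub (fun x _ _ => sq_nonneg (e x))
          have hy₀not : y₀ ∉ ({y₁, y₂, y} : Finset (Fin (6 + 6) → Bool)) := by
            rw [mem_insert, mem_insert, mem_singleton, not_or, not_or]; exact ⟨Ne.symm hy₁₀, Ne.symm hy₂₀, Ne.symm hyy₀⟩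
          have hy₁not : y₁ ∉ ({y₂, y} : Finset (Fin (6 + 6) → Bool)) := by
            rw [mem_insert, mem_singleton, not_or]; exact ⟨Ne.symm hy₂₁, Ne.symm hyy₁⟩
          have hy₂not : y₂ ∉ ({y} : Finset (Fin (6 + 6) → Bool)) := by rw [mem_singleton]; exact Ne.symm hyy₂
          rw [sum_insert hy₀not, sum_insert hy₁not, sum_insert hy₂not, sum_singleton] at this
          linarith
        have := hsq256 y₀ hy₀ hne'
        have := hsq256 y₁ hy₁ hne₁
        have := hsq256 y₂ hy₂ hne₂
        have := hsq256 y hy hy0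
        linarith
      have hsum3 : ∑ x ∈ univ.filter (fun x => x ∉ P), e x = e y₀ + (e y₁ + e y₂) := by
        have hsub : ({y₀, y₁, y₂} : Finset (Fin (6 + 6) → Bool)) ⊆ univ.filter (fun x => x ∉ P) := by
          intro z hz
          rcases mem_insert.1 hz with rfl | hz
          · exact hmem₀
          rcases mem_insert.1 hz with rfl | hz
          · exact hmem₁
          · rw [mem_singleton.1 hz]; exact hmem₂
        rw [← sum_subset hsub (fun x hx hxn => by
          rw [mem_insert, mem_insert, mem_singleton, not_or, not_or] at hxn
          exact hothers x (mem_filter.1 hx).2 hxn.1 hxn.2.1 hxn.2.2)]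
        have hy₀not : y₀ ∉ ({y₁, y₂} : Finset (Fin (6 + 6) → Bool)) := by
          rw [mem_insert, mem_singleton, not_or]; exact ⟨Ne.symm hy₁₀, Ne.symm hy₂₀⟩
        have hy₁not : y₁ ∉ ({y₂} : Finset (Fin (6 + 6) → Bool)) := by rw [mem_singleton]; exact Ne.symm hy₂₁
        rw [sum_insert hy₀not, sum_insert hy₁not, sum_singleton]
      have hdec := hdecomp (univ.filter (fun x => x ∉ P))
      obtain ⟨m, hm⟩ := h128
      obtain ⟨z, hz⟩ := h16
      rw [hsum3, hm, hz] at hdec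
      rcases he₀ with h0 | h0 <;> rcases he₁ with h1 | h1 <;> rcases he₂ with h2 | h2 <;> rw [h0, h1, h2] at hdec <;> omega
    · /- exactly TWO non-zero points off `P`: a separating coordinate -/
      push Not at hex2
      have hothers : ∀ y, y ∉ P → y ≠ y₀ → y ≠ y₁ → e y = 0 := fun y hy hyy₀ hyy₁ => by
        by_contra h; exact h (hex2 y hy hyy₀ hyy₁)
      obtain ⟨j, hj⟩ : ∃ j, y₀ j ≠ y₁ j := by
        by_contra hall
        push Not at hall
        exact hy₁₀ (funext fun j => (hall j).symm)
      cases hy₀j : y₀ j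
      · have hy₁j : y₁ j = true := by
          cases h : y₁ j
          · exact absurd (hy₀j.trans h.symm) hj
          · rfl
        exact hsep j y₀ hy₀ hy₀j he₀ fun y hy hyj hyy₀ => by
          by_cases hyy₁ : y = y₁
          · rw [hyy₁] at hyj; rw [hy₁j] at hyj; exact absurd hyj (by decide)
          · exact hothers y hy hyy₀ hyy₁
      · have hy₁j : y₁ j = false := by
          cases h : y₁ j
          · rfl
          · exact absurd (hy₀j.trans h.symm) hj
        exact hsep j y₁ hy₁ hy₁j he₁ fun y hy hyj hyy₁ => by
          by_cases hyy₀ : y = y₀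
          · rw [hyy₀] at hyj; rw [hy₀j] at hyj; exact absurd hyj (by decide)
          · exact hothers y hy hyy₀ hyy₁
  · /- `y₀` is the only non-zero point off `P`: `Σ_{P^c} e = e(y₀) = ±16 ∉ 32ℤ` -/
    push Not at hex
    have hothers : ∀ y, y ∉ P → y ≠ y₀ → e y = 0 := fun y hy hyy => by
      by_contra h; exact h (hex y hy hyy)
    have he16 := hval y₀ hy₀ hne'
    have hsumoff : ∑ x ∈ univ.filter (fun x => x ∉ P), e x = e y₀ :=
      sum_eq_single_of_mem y₀ hmem₀ fun x hx hxy => hothers x (mem_filter.1 hx).2 hxy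
    have hdec := hdecomp (univ.filter (fun x => x ∉ P))
    obtain ⟨m, hm⟩ := h128
    obtain ⟨z, hz⟩ := h16
    rw [hsumoff, hm, hz] at hdec
    rcases he16 with h | h <;> rw [h] at hdec <;> omega

end Summit.QuantumAdvantage.QuantumAdvantage.Theorems.CubicForrelation.NearExactIsExact

end
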